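import Literature.MathematicalPhysics.QuantumFieldTheory.Balaban1983to89.Setup

/-!
# `Balaban1983to89.B15StandardRep` — T. Bałaban, *Large field renormalization. I. The basic step of the 𝐑 operation*,
Commun. Math. Phys. **122** (1989) 175–202 [Balaban1989LargeFieldI]: the "STANDARD REPRESENTATION" identities of
background fields by `ℍ`-functions — (1.30), (1.34)–(1.36), (1.40)–(1.41), (1.44), (1.56), (1.58), (1.85)–(1.86),
(1.90), (1.92)–(1.93) — and the configuration (1.97), typed as explicit algebraic SCHEMAS over the `Setup` gauge fields

statement-level skeleton of published theorems with citation tags; proofs where landed; nothing here is a claim about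
the Yang–Mills mass gap

PDF held: `paper:balaban1989-cmp122-large-field-i` (journal page = PDF page + 174).  Every quotation below was READ AS AN
IMAGE on the x2 renders `run/shared/lean/pub/pub-balaban/b2b-balaban-ref1/pages/1989-cmp122-large-field-I/…-p009,p010,
p011,p012,p014,p023,p024,p025-x2.png`.  References of the paper used here: [III] = [Balaban1988Convergent] ((3.6)–(3.8)
p. 265–266: the representation of the localized background `U_{k,□}`), [12] = [Balaban1985Averaging] ((106)–(108),
(159)–(163): the induced averages `M̃^j`, `Q̃_j`, `R̄^j`), [14] = [Balaban1985RegularSpaces] ((1.65)), [15] =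
[Balaban1985Variational] (Prop. 9 p. 309: *"The function U_k(V′V₀)U_k(V₀)⁻¹ transformed to the Landau gauge is, by the
definition, equal to exp iη𝓗(B), where B = (1/i) log V′"* — typed abstractly in `…B11.Prop9Printed` over `…B11.AnData`).

CITATION HEADER / WHAT IS REPRODUCED (mega-formalization `lit-balaban`, reader/typer r12 gen 2, Phase 1 continued; HOME
`run/shared/lean/pub/lit-balaban/`, rows `lit-balaban-r12/ROWS-B15.md` v3): SKELETON rows B15.Eq1.30, B15.Eq1.34–1.36,
B15.Eq1.40–1.41, B15.Eq1.44, B15.Eq1.56, B15.Eq1.58, B15.Eq1.85–1.86, B15.Eq1.90, B15.Eq1.92–1.93, B15.Eq1.97 — `absent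
· operator identity` at SKELETON v3.9 (`lit-balaban-r12/INTERFACES-r12.md` (b): "a named ℍ-operator interface").  Every
display is ONE algebraic identity between gauge-field configurations of the SHAPE
  `U = (exp(i·s·ℍ(B)) · U₀)^{u⁻¹}`, `B = (1/i) log[V V₀⁻¹]`  (B11 Prop. 9, [III] (3.6), here `StdRep`)
or of its averaged form `M^j(U) = exp(iℍ^{(j)}) · M^j(U₀)` with `exp iℍ^{(j)}(b) = u⁻¹(b₋) exp iQ̃_j(sℍ, b) R̄^j(u(b₊))`
([12] (106)–(108), here `AvgRep`/`InducedH`), and is typed as a `def … : Prop` whose arguments are exactly the printed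
ingredients (which configuration, which base configuration, which data enter the logarithm, which scale factor `s`).

READING (declared, not printed).  (a) The exponential chart of the gauge group — `exp i(·) : 𝔤 → G`, `(1/i) log : G → 𝔤`
([I] p. 252: *"U′ = exp iA′, A′ ∈ 𝐠ᶜ"*) — is DATA `LieChart G 𝔤` over `Setup`'s abstract `GaugeGroup` (no analytic
property is assumed or used; concrete matrix models: `…BlockAveragingFederbushGValued.LogChart`, `…MatrixLog.mlog`);
`exp(i s A)·U` is the bondwise left multiplication `expMul` (as `U = U′U₀`, [15] (15)).  (b) The `ℍ`-functions
`ℍ_{j,□}`, `ℍ^{(n)}_{k,Z}`, `ℍ_{k,Λ}`, `ℍ_{h,□}` ([III] (3.6), [15] (174)) are explicit FUNCTION arguments from data fields to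
fine-lattice vector fields; the induced objects `M̃^j(exp iξℍ)`, `Q̃_j(ξℍ, ·)`, `R̄^j u`, `u↾T^{(j)}` of [12] are explicit
arguments of the scale-`j` statements; the gauge transformations `u_{j,□}`, `u`, `u₀`, … (Landau gauge) are arguments.
(c) The solution maps `U(𝔹_k(Λ), ·)`, `U(𝔹_h(□^{∼4}), ·)`, `U(𝔹″_{k,Z} ∪ 𝔹_h(Ω″^{∼2}_{h+1}), ·)` in (1.85), (1.90), (1.97)
are arguments `sol : (Π j, GaugeField P j G) → GaugeField P 0 G` (= `…B15DeterminingSets.DetBackground.U 𝔹`, filed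
separately; this module imports `Setup` only).  (d) `M˙(U)` = the family `j ↦ M^j(U)` (`Setup.Averaging.iter`).
NOT typed here: the printed BOUNDS attached to these identities ((1.31), (1.37)–(1.38), (1.42), (1.45)–(1.48), (1.57),
(1.84), (1.87), (1.91), (1.94)–(1.96), (1.98)) — they are the leaves of `…B15.BasicStep` / `…B15.PrelimIntegrations`;
only the three support-and-size sentences printed WITH (1.30), (1.56), (1.90) are typed (`SmallOffLayer`).  Every
declaration is a definition or a definitional unfolding; nothing printed is asserted as a fact.
-/

namespace Literature.MathematicalPhysics.QuantumFieldTheory.Balaban1983to89.B15StandardRep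

variable {P : Params} {G : Type*} [GaugeGroup G] {𝔤 : Type*} [NormedAddCommGroup 𝔤] [NormedSpace ℝ 𝔤]

/-! ## Part A. The schema: exponential chart, `exp(i s A)·U`, `(1/i) log[V V₀⁻¹]`, the three printed shapes -/

/-- The exponential chart of the gauge group as DATA: `expI A = exp(iA) ∈ G` for `A` in the (complexified) Lie algebra
`𝔤`, `logI U = (1/i) log U` (READING (a); [I] p. 252: *"Elements of this group are defined as matrices of the form
𝐔 = U′U, where U ∈ G and U′ = exp iA′, A′ ∈ 𝐠ᶜ"*). [cite: Balaban1987RG1, p.252 (U′ = exp iA′)] -/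
structure LieChart (G : Type*) (𝔤 : Type*) where
  expI : 𝔤 → G
  logI : G → 𝔤

/-- `exp(i s A)·U`: the configuration `U` multiplied bondwise on the left by `exp(i s A(b))` — the form
*"(exp iξℍ(…)) U"* common to (1.30), (1.34), (1.44), (1.56), (1.86), (1.90), (1.93). [cite: Balaban1989LargeFieldI, (1.30) p.183] -/
def expMul {j : ℕ} (χ : LieChart G 𝔤) (s : ℝ) (A : VecField P j 𝔤) (U : GaugeField P j G) : GaugeField P j G :=
  fun b => χ.expI (s • A b) * U b

/-- `(1/i) log[V W⁻¹]` bondwise on every scale — the argument fields *"(1/i) log[M˙(U)(M˙(Q^{s*}V))⁻¹]"* of the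
`ℍ`-functions in (1.30), (1.34), (1.56), (1.90). [cite: Balaban1989LargeFieldI, (1.30) p.183] -/
def logRatio (χ : LieChart G 𝔤) (V W : (j : ℕ) → GaugeField P j G) : (j : ℕ) → VecField P j 𝔤 :=
  fun j b => χ.logI (V j b * (W j b)⁻¹)

/-- The inverse gauge transformation `u⁻¹` (pointwise). [cite: Balaban1989LargeFieldI, (1.30) p.183] -/
def invTransf {j : ℕ} (u : GaugeTransf P j G) : GaugeTransf P j G := fun x => (u x)⁻¹

/-- **THE STANDARD REPRESENTATION** (shape of (1.30), (1.34), (1.44), (1.56), (1.86), (1.90), (1.93); [15] Prop. 9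
p. 309: *"The function U_k(V′V₀)U_k(V₀)⁻¹ transformed to the Landau gauge is, by the definition, equal to exp iη𝓗(B),
where B = (1/i) log V′"*; [III] (3.6)): `U = (exp(i s ℍB) · U₀)^{u⁻¹}` — `U` the represented configuration, `U₀` the base
configuration, `HB` the fine-lattice field `ℍ(B)` (the `ℍ`-function ALREADY applied to its argument), `s` the scale
factor (`ξ`, `η`, `L^{k−h}η`, …), `u` the gauge transformation to the Landau gauge. [cite: Balaban1989LargeFieldI, (1.30) p.183] -/
def StdRep (χ : LieChart G 𝔤) (s : ℝ) (HB : VecField P 0 𝔤) (u : GaugeTransf P 0 G) (U U₀ : GaugeField P 0 G) : Prop :=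
  U = GaugeField.gaugeAct (invTransf u) (expMul χ s HB U₀)

/-- The standard representation unfolded bondwise: `U(b) = u(b₋)⁻¹ · exp(i s ℍB(b)) · U₀(b) · u(b₊)` (definitional). [cite: Balaban1989LargeFieldI, (1.30) p.183] -/
theorem stdRep_iff (χ : LieChart G 𝔤) (s : ℝ) (HB : VecField P 0 𝔤) (u : GaugeTransf P 0 G) (U U₀ : GaugeField P 0 G) :
    StdRep χ s HB u U U₀ ↔ ∀ b, U b = (u b.src)⁻¹ * (χ.expI (s • HB b) * U₀ b) * u b.tgt := by
  unfold StdRep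
  constructor
  · intro h b
    rw [h]
    show (u b.src)⁻¹ * (χ.expI (s • HB b) * U₀ b) * ((u b.tgt)⁻¹)⁻¹ = _
    rw [inv_inv]
  · intro h
    funext b
    rw [h b]
    show _ = (u b.src)⁻¹ * (χ.expI (s • HB b) * U₀ b) * ((u b.tgt)⁻¹)⁻¹
    rw [inv_inv]

/-- **THE AVERAGED REPRESENTATION** (shape of (1.35), (1.40), (1.58)): on the scale-`j` bonds,
`V = exp(iℍ^{(j)}) · V_Z` — `V` the represented average, `VZ` the base average, `Hj` the induced field `ℍ^{(j)}`. [cite: Balaban1989LargeFieldI, (1.35) p.184] -/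
def AvgRep {j : ℕ} (χ : LieChart G 𝔤) (Hj : VecField P j 𝔤) (VZ V : GaugeField P j G) : Prop :=
  ∀ b, V b = χ.expI (Hj b) * VZ b

/-- **THE INDUCED FIELD** (shape of (1.36), (1.41); [12] (106)–(108)): `exp iℍ^{(j)}(b) = u_j⁻¹(b₋) exp iQ̃_j(sℍ, b)
R̄^j(u_j(b₊))` — `ujR` = `u_j` at the points of `T^{(j)}`, `Qt b` = `Q̃_j(sℍ, b)`, `ubar` = `R̄^j(u_j)` (READING (b)). [cite: Balaban1989LargeFieldI, (1.36) p.184] -/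
def InducedH {j : ℕ} (χ : LieChart G 𝔤) (Hj Qt : VecField P j 𝔤) (ujR ubar : GaugeTransf P j G) : Prop :=
  ∀ b, χ.expI (Hj b) = (ujR b.src)⁻¹ * χ.expI (Qt b) * ubar b.tgt

/-- The support-and-size sentences printed with (1.30), (1.56), (1.90): a multi-scale field `B` (the argument of the
`ℍ`-function) VANISHES off a boundary layer (`layer j` = its scale-`j` bonds) and is bounded by `c` on it. [cite: Balaban1989LargeFieldI, (1.30) p.183] -/
def SmallOffLayer (B : (j : ℕ) → VecField P j 𝔤) (layer : (j : ℕ) → Set (PBond P j)) (c : ℝ) : Prop :=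
  ∀ j b, (b ∉ layer j → B j b = 0) ∧ (b ∈ layer j → ‖B j b‖ ≤ c)

/-! ## Part B. The identities of the proof of (1.29), pp. 183–188 -/

section Proof129

variable (χ : LieChart G 𝔤)

/-- **(1.30)** p. 183 [PDF 9], verbatim: *"Reasoning as in the part of Sect. 3 [III] between the formulas (3.6), (3.8), we
get U_{j,□} = (exp iξℍ_{j,□}(−(1/i) log[M˙(U_k^{(n)})(M˙(Q_j^{s*}V_j))⁻¹]) U_k^{(n)})^{u⁻¹_{j,□}}. (1.30)"* (context: *"The
cube □ is contained in Ω_j^{∼4}∖Ω^∼_{j+1} … On this domain the configuration U_k^{(n)} satisfies the last inequality in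
(1.24) (with c = 1), and the constraints M^j(U_k^{(n)}) = V_j. The same constraints are satisfied by U_{j,□} on □^{∼3}."*).
`Ubox` = `U_{j,□}` (= `U(𝔹_j(□^{∼4}), M˙(Q_j^{s*}V_j))`, [III] (2.16)), `Un` = `U_k^{(n)}` ((1.18)), `MUn` = `M˙(U_k^{(n)})`,
`MQV` = `M˙(Q_j^{s*}V_j)`, `H` = `ℍ_{j,□}`, `u` = `u_{j,□}`, `ξ = L^{−j}`. [cite: Balaban1989LargeFieldI, (1.30) p.183] -/
def Rep130 (ξ : ℝ) (H : ((j : ℕ) → VecField P j 𝔤) → VecField P 0 𝔤) (u : GaugeTransf P 0 G)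
    (Ubox Un : GaugeField P 0 G) (MUn MQV : (j : ℕ) → GaugeField P j G) : Prop :=
  StdRep χ ξ (H (-logRatio χ MUn MQV)) u Ubox Un

/-- (1.30), the sentence after it, p. 183, verbatim: *"The field in the argument of the function ℍ_{j,□} is equal to 0 on
almost the whole cube □^{∼4}, except a boundary layer of the width 2M₁ in the lattice T_ξ, ξ = L^{−j}. On this boundary
the field can be bounded by 22d²ε_j, by the argument leading to the estimate (1.65) in [14]."* (`layer` = the bonds of the
boundary layer). [cite: Balaban1989LargeFieldI, (1.30) p.183] -/
def Layer130 (MUn MQV : (j : ℕ) → GaugeField P j G) (layer : (j : ℕ) → Set (PBond P j)) (d εj : ℝ) : Prop :=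
  SmallOffLayer (-logRatio χ MUn MQV) layer (22 * d ^ 2 * εj)

/-- **(1.34)** p. 184 [PDF 10], verbatim: *"Now we represent the configuration U(·) in the standard way, as in (1.30)
U(𝔹(Z_{j+1}∖Z_j) ∪ 𝔹_k, M˙(Q^{s*}V)) = U(𝔹(Z_{j+1}∖Z_j) ∪ 𝔹_k, [M˙(Q^{s*}V)(M˙(U_k^{(n+1)}))⁻¹]M˙(U_k^{(n+1)})) =
(exp iξℍ(𝔹(Z_{j+1}∖Z_j) ∪ 𝔹_k, −(1/i) log[M˙(U_k^{(n+1)})(M˙(Q^{s*}V))⁻¹]) U_k^{(n+1)})^{u_j⁻¹}. (1.34)"* — the same shape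
as (1.30): `Useam` = the left side ((1.33)), `Un1` = `U_k^{(n+1)}`, `MUn1` = `M˙(U_k^{(n+1)})`, `MQV` = `M˙(Q^{s*}V)`, `H` = the
`ℍ`-function of the determining set `𝔹(Z_{j+1}∖Z_j) ∪ 𝔹_k`, `u` = `u_j`. [cite: Balaban1989LargeFieldI, (1.34) p.184] -/
def Rep134 (ξ : ℝ) (H : ((j : ℕ) → VecField P j 𝔤) → VecField P 0 𝔤) (u : GaugeTransf P 0 G)
    (Useam Un1 : GaugeField P 0 G) (MUn1 MQV : (j : ℕ) → GaugeField P j G) : Prop :=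
  Rep130 χ ξ H u Useam Un1 MUn1 MQV

/-- **(1.35)** p. 184, verbatim: *"This implies V^{(j)}_{Z_{j+1}∖Z_j} = (M̃^j(exp iξℍ)M^j(U_k^{(n+1)}))^{u_j⁻¹} =
exp iℍ^{(j)}V_Z^{(j)}, (1.35)"* — both equalities, on the scale-`j` bonds: `Mt` = `M̃^j(exp iξℍ)` ([12]), `MjUn1` =
`M^j(U_k^{(n+1)})`, `ujR` = `u_j` at the points of `T^{(j)}`, `VZ` = `V_Z^{(j)}` ((1.26)), `Hj` = `ℍ^{(j)}` ((1.36)). [cite: Balaban1989LargeFieldI, (1.35) p.184] -/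
def Rep135 {j : ℕ} (Mt MjUn1 VZ Vseam : GaugeField P j G) (ujR : GaugeTransf P j G) (Hj : VecField P j 𝔤) : Prop :=
  (Vseam = GaugeField.gaugeAct (invTransf ujR) (fun b => Mt b * MjUn1 b)) ∧ AvgRep χ Hj VZ Vseam

/-- **(1.36)** p. 184, verbatim: *"where exp iℍ^{(j)}(b) = u_j⁻¹(b₋) exp iQ̃_j(ξℍ, b) R̄^j(u_j(b₊)). (1.36)"* (`Qt b` =
`Q̃_j(ξℍ, b)`, `ubar` = `R̄^j(u_j)`, [12] (106)–(108)). [cite: Balaban1989LargeFieldI, (1.36) p.184] -/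
def Rep136 {j : ℕ} (Hj Qt : VecField P j 𝔤) (ujR ubar : GaugeTransf P j G) : Prop := InducedH χ Hj Qt ujR ubar

/-- **(1.40)** p. 185 [PDF 11], verbatim: *"The configuration V^{(j)}_{□′} is equal to M^j(U_{j+1,□′}). For U_{j+1,□′} we have
the representation (1.30), with j, n, □, and ξ replaced by j + 1, n + 1, □′, and L⁻¹ξ. This representation implies
V^{(j)}_{□′} = (M̃^j(exp iL⁻¹ξℍ_{j+1,□′})M^j(U_k^{(n+1)}))^{u⁻¹_{j+1,□′}} = exp iℍ^{(j)}_{□′}V_Z^{(j)}, (1.40)"* — the shape of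
(1.35) with `Mt` = `M̃^j(exp iL⁻¹ξℍ_{j+1,□′})`, `ujR` = `u_{j+1,□′}` at the points of `T^{(j)}`, `Hj` = `ℍ^{(j)}_{□′}`. [cite: Balaban1989LargeFieldI, (1.40) p.185] -/
def Rep140 {j : ℕ} (Mt MjUn1 VZ Vbox : GaugeField P j G) (ujR : GaugeTransf P j G) (Hj : VecField P j 𝔤) : Prop :=
  Rep135 χ Mt MjUn1 VZ Vbox ujR Hj

/-- **(1.41)** p. 185, verbatim: *"where exp iℍ^{(j)}_{□′}(b) = u⁻¹_{j+1,□′}(b₋) exp iQ̃_j(L⁻¹ξℍ_{j+1,□′}, b) R̄^j(u_{j+1,□′}(b₊)).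
(1.41)"* (`Qt b` = `Q̃_j(L⁻¹ξℍ_{j+1,□′}, b)`). [cite: Balaban1989LargeFieldI, (1.41) p.185] -/
def Rep141 {j : ℕ} (Hj Qt : VecField P j 𝔤) (ujR ubar : GaugeTransf P j G) : Prop := InducedH χ Hj Qt ujR ubar

/-- **(1.44)** p. 186 [PDF 12], verbatim: *"Representing the field V_j on Ω^c_{j+1}∖Z″_{j+1} as [V_j(V_Z^{(j)})⁻¹]V_Z^{(j)}, we
have U^{(n)}_{k,Z} = (exp iηℍ^{(n)}_{k,Z}((1/i) log[V_j(V_Z^{(j)})⁻¹]) U^{(n+1)}_{k,Z})^{u⁻¹}. (1.44)"* — `UnZ` = `U^{(n)}_{k,Z}`,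
`Un1Z` = `U^{(n+1)}_{k,Z}` ((1.20)), `Vj`, `VZ` = `V_Z^{(j)}` on the scale-`j` bonds, `Hn` = `ℍ^{(n)}_{k,Z}` (a function of the
scale-`j` field `(1/i) log[V_j(V_Z^{(j)})⁻¹]`), scale factor `η`. [cite: Balaban1989LargeFieldI, (1.44) p.186] -/
def Rep144 {j : ℕ} (η : ℝ) (Hn : VecField P j 𝔤 → VecField P 0 𝔤) (u : GaugeTransf P 0 G) (UnZ Un1Z : GaugeField P 0 G)
    (Vj VZ : GaugeField P j G) : Prop :=
  StdRep χ η (Hn (fun b => χ.logI (Vj b * (VZ b)⁻¹))) u UnZ Un1Z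

/-- **(1.56)** p. 188 [PDF 14], verbatim: *"Once more we write the representation U_k^{(n+1)} = (exp iηℍ^{(n+1)}_{k,Z}((1/i)
log[M˙(U_k^{(n+1)})(M˙(Q_k^{s*}V_k))⁻¹]) U^{(n+1)}_{k,Z})^{(u^{(n+1)}_{k,Z})⁻¹}. (1.56)"* — `Un1` = `U_k^{(n+1)}`, `Un1Z` =
`U^{(n+1)}_{k,Z}`, `MUn1` = `M˙(U_k^{(n+1)})`, `MQVk` = `M˙(Q_k^{s*}V_k)`, `Hn1` = `ℍ^{(n+1)}_{k,Z}`, `u` = `u^{(n+1)}_{k,Z}`. [cite: Balaban1989LargeFieldI, (1.56) p.188] -/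
def Rep156 (η : ℝ) (Hn1 : ((j : ℕ) → VecField P j 𝔤) → VecField P 0 𝔤) (u : GaugeTransf P 0 G)
    (Un1 Un1Z : GaugeField P 0 G) (MUn1 MQVk : (j : ℕ) → GaugeField P j G) : Prop :=
  StdRep χ η (Hn1 (logRatio χ MUn1 MQVk)) u Un1 Un1Z

/-- (1.56), the sentence after it, p. 188, verbatim: *"The field in the argument of the function ℍ^{(n+1)}_{k,Z} has a support
in the boundary layer of the width 2M₁ at the boundary of Z, and is bounded by 44d²B₃ε_k."* [cite: Balaban1989LargeFieldI, (1.56) p.188] -/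
def Layer156 (MUn1 MQVk : (j : ℕ) → GaugeField P j G) (layer : (j : ℕ) → Set (PBond P j)) (d B₃ εk : ℝ) : Prop :=
  SmallOffLayer (logRatio χ MUn1 MQVk) layer (44 * d ^ 2 * B₃ * εk)

/-- **(1.58)** p. 188, verbatim: *"For the averages V^{(j)}, V_Z^{(j)} we have, as in (1.40) V^{(j)} = exp iℍ_Z^{(j)}V_Z^{(j)},
(1.58) where ℍ_Z^{(j)} is given by the formula corresponding to (1.41). It is an analytic function of the configuration
U_k^{(n+1)} restricted to Z, and on (Ω^c_{j+1}∖Z″_j)^{(j)} it is bounded by O(1) exp(−R_j)ε_j."* — the identity (the bound and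
the analyticity are not typed): `Vup` = `V^{(j)} = M^j(U_k^{(n+1)})` ((1.53)), `VZ` = `V_Z^{(j)}`, `HZ` = `ℍ_Z^{(j)}`. [cite: Balaban1989LargeFieldI, (1.58) p.188] -/
def Rep158 {j : ℕ} (HZ : VecField P j 𝔤) (VZ Vup : GaugeField P j G) : Prop := AvgRep χ HZ VZ Vup

end Proof129

/-! ## Part C. The identities of the last integration, pp. 197–199 -/

section LastStep

variable (χ : LieChart G 𝔤) (av : ∀ j, Averaging P j G)

/-- **(1.85)** p. 197 [PDF 23], verbatim: *"The field U₀ can be represented inside Λ as follows: U₀ = U(𝔹_k(Λ), M˙(U₀)).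
(1.85)"* — `U₀` of (1.79) is the minimizer for ITS OWN data on the localized determining set `𝔹_k(Λ)`: `sol` = the
solution map `U(𝔹_k(Λ), ·)` (READING (c)), `M˙(U₀)` = `j ↦ M^j(U₀)`. [cite: Balaban1989LargeFieldI, (1.85) p.197] -/
def Rep185 (sol : ((j : ℕ) → GaugeField P j G) → GaugeField P 0 G) (U0 : GaugeField P 0 G) : Prop :=
  U0 = sol (fun j => Averaging.iter av j U0)

/-- The field `𝔸₀ = ℍ_{k,Λ}((1/i) log M˙(U₀))` of (1.86)–(1.87) p. 197 (verbatim: *"The function 𝔸₀ =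
ℍ_{k,Λ}((1/i) log M˙(U₀)) is also an analytic function of (1/i) log M˙(U₀)"*). [cite: Balaban1989LargeFieldI, (1.87) p.197] -/
def fieldA0 (H : ((j : ℕ) → VecField P j 𝔤) → VecField P 0 𝔤) (U0 : GaugeField P 0 G) : VecField P 0 𝔤 :=
  H (fun j b => χ.logI (Averaging.iter av j U0 b))

/-- **(1.86)** p. 197, verbatim: *"We transform the function to the Landau gauge constructed around this configuration
[identically equal to 1], and we get U₀ = (exp iηℍ_{k,Λ}((1/i) log M˙(U₀)))^{u₀⁻¹}. (1.86) Thus U₀^{u₀} is in the required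
gauge, and we have U₀^{u₀} = U₀^{(AL)} = exp iη𝔸₀ inside Λ"* — the standard representation around the configuration `1`
(`H` = `ℍ_{k,Λ}`, `u0` = `u₀`), together with the `(AL)`-gauge sentence on the bonds `Λb` of `Λ`. [cite: Balaban1989LargeFieldI, (1.86) p.197] -/
def Rep186 (η : ℝ) (H : ((j : ℕ) → VecField P j 𝔤) → VecField P 0 𝔤) (u0 : GaugeTransf P 0 G) (U0 : GaugeField P 0 G)
    (Λb : Set (PBond P 0)) : Prop :=
  StdRep χ η (fieldA0 χ av H U0) u0 U0 1 ∧
    ∀ b ∈ Λb, GaugeField.gaugeAct u0 U0 b = expMul χ η (fieldA0 χ av H U0) 1 b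

/-- **(1.90)** p. 198 [PDF 24], verbatim: *"Take a cube □ ⊂ (Ω″^∼_{h+1})ᶜ ∩ Ω_h, and represent the functions U″_{k,Z} on □^∼
in the usual way: U″_{k,Z} = U(𝔹_h(□^{∼4}), [M˙(U″_{k,Z})(M˙(Q_h^{s*}V″))⁻¹]M˙(Q_h^{s*}V″)) = (exp iL^{k−h}ηℍ_{h,□}((1/i)
log[M˙(U″_{k,Z})(M˙(Q_h^{s*}V″))⁻¹]) U_{h,□}(V″))^{u⁻¹_{h,□}}. (1.90)"* — both equalities: `sol` = `U(𝔹_h(□^{∼4}), ·)`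
(READING (c)), `Upp` = `U″_{k,Z}` ((1.21)), `MUpp` = `M˙(U″_{k,Z})`, `MQV` = `M˙(Q_h^{s*}V″)`, `Uhbox` = `U_{h,□}(V″)`, `H` =
`ℍ_{h,□}`, `u` = `u_{h,□}`, `Lpow = L^{k−h}`. [cite: Balaban1989LargeFieldI, (1.90) p.198] -/
def Rep190 (Lpow η : ℝ) (sol : ((j : ℕ) → GaugeField P j G) → GaugeField P 0 G)
    (H : ((j : ℕ) → VecField P j 𝔤) → VecField P 0 𝔤) (u : GaugeTransf P 0 G) (Upp Uhbox : GaugeField P 0 G)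
    (MUpp MQV : (j : ℕ) → GaugeField P j G) : Prop :=
  Upp = sol (fun j b => MUpp j b * (MQV j b)⁻¹ * MQV j b) ∧ StdRep χ (Lpow * η) (H (logRatio χ MUpp MQV)) u Upp Uhbox

/-- (1.90), the sentence after it, p. 198, verbatim: *"The function ℍ_{h,□} and it[s] derivatives can be bounded on □^∼ by
B₃ exp(−δ2LM₂R_h)11d²ε_h < 11d²B₃ exp(−R_h)ε_h < αε_h, where α is a small, absolute constant, which will be fixed
later."* — the first inequality for the size `sH` of `ℍ_{h,□}` (the numeric continuation is `…B15.PrelimIntegrations.Ineq191`). [cite: Balaban1989LargeFieldI, (1.90) p.198] -/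
def BoundH190 (sH B₃ δ L M₂ Rh d εh : ℝ) : Prop := sH ≤ B₃ * Real.exp (-(δ * 2 * L * M₂ * Rh)) * (11 * d ^ 2) * εh

/-- **(1.92)** p. 198, verbatim: *"The field V″ is equal to V_h on (Ω″^{∼2}_{h+1})ᶜ ∩ □^{∼4}, and on Ω″^{∼2}_{h+1} ∩ □^{∼4} it is
equal to V″ = V′M^h(U₀^{(AL)}) = exp iB′ exp iQ̃_h(η𝔸₀). (1.92)"* — both equalities on the scale-`h` bond set `S` (the bonds
of `Ω″^{∼2}_{h+1} ∩ □^{∼4}`): `Vp` = `V′` ((1.81)), `MhU0` = `M^h(U₀^{(AL)})`, `Bp` = `B′` ((1.82)), `Qt b` = `Q̃_h(η𝔸₀, b)`. [cite: Balaban1989LargeFieldI, (1.92) p.198] -/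
def Rep192 {h : ℕ} (S : Set (PBond P h)) (Vpp Vp MhU0 : GaugeField P h G) (Bp Qt : VecField P h 𝔤) : Prop :=
  ∀ b ∈ S, Vpp b = Vp b * MhU0 b ∧ Vpp b = χ.expI (Bp b) * χ.expI (Qt b)

open Classical in
/-- The argument field of (1.93): `(1/i) log V″` on the bonds `S` of `Ω″^{∼2}_{h+1}`, zero elsewhere (*"(1/i) log
V″↾_{Ω″^{∼2}_{h+1}}"*). [cite: Balaban1989LargeFieldI, (1.93) p.198] -/
noncomputable def logOn {h : ℕ} (S : Set (PBond P h)) (Vpp : GaugeField P h G) : VecField P h 𝔤 :=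
  fun b => if b ∈ S then χ.logI (Vpp b) else 0

/-- **(1.93)** p. 198, verbatim: *"Expanding U_{h,□}(V″) with respect to the above field, we get U_{h,□}(V″) =
(exp iL^{k−h}ηℍ_{h,□}((1/i) log V″↾_{Ω″^{∼2}_{h+1}}) U_{h,□}(1, V_h))^{u′⁻¹_{h,□}}. (1.93)"* — `Uhbox` = `U_{h,□}(V″)`, `Uhbox1`
= `U_{h,□}(1, V_h)` (p. 198: the configuration `(1↾_{Ω″^{∼2}_{h+1}}, V_h↾_{(Ω″^{∼2}_{h+1})ᶜ})`), `H1` = `ℍ_{h,□}` as a function of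
the scale-`h` field, `u` = `u′_{h,□}`. [cite: Balaban1989LargeFieldI, (1.93) p.198] -/
def Rep193 {h : ℕ} (Lpow η : ℝ) (H1 : VecField P h 𝔤 → VecField P 0 𝔤) (u : GaugeTransf P 0 G)
    (Uhbox Uhbox1 : GaugeField P 0 G) (S : Set (PBond P h)) (Vpp : GaugeField P h G) : Prop :=
  StdRep χ (Lpow * η) (H1 (logOn χ S Vpp)) u Uhbox Uhbox1

open Classical in
/-- **(1.97)** p. 199 [PDF 25], verbatim: *"This yields the bound (1.91) with h replaced by j, and the configuration
U_{h,□}(V″) replaced by U(𝔹″_{k,Z} ∪ 𝔹_h(Ω″^{∼2}_{h+1}), (exp iB′M˙(U₀^{(AL)})↾_{Σᶜ}, M˙(U₀^{(AL)})↾_Σ)). (1.97)"* (p. 199: *"The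
above field is equal to V″ outside the layer of thickness 2M₁ (in L^{−h}-scale) at the boundary ∂Ω″^{∼2}_{h+1}. Denote
this layer by Σ."*) — the configuration as a value of the solution map `sol` = `U(𝔹″_{k,Z} ∪ 𝔹_h(Ω″^{∼2}_{h+1}), ·)`
(READING (c)) at the spliced data: `exp(iB′)·M˙(U₀^{(AL)})` off `Σ`, `M˙(U₀^{(AL)})` on `Σ` (`Sig j` = the scale-`j` bonds
of `Σ`, `MU0 = M˙(U₀^{(AL)})`, `Bp = B′`). [cite: Balaban1989LargeFieldI, (1.97) p.199] -/
noncomputable def cfg197 (sol : ((j : ℕ) → GaugeField P j G) → GaugeField P 0 G) (Sig : (j : ℕ) → Set (PBond P j))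
    (Bp : (j : ℕ) → VecField P j 𝔤) (MU0 : (j : ℕ) → GaugeField P j G) : GaugeField P 0 G :=
  sol (fun j b => if b ∈ Sig j then MU0 j b else χ.expI (Bp j b) * MU0 j b)

omit [NormedSpace ℝ 𝔤] in
/-- (1.97) with `B′ = 0` (p. 199, verbatim: *"with U_{h,□}(V″) replaced by (1.97) for B′ = 0. This configuration is equal to
U₀^{ū₀}, where ū₀ is a gauge transformation constant in blocks of the determining set of (1.97)"*): at `B′ = 0` the
spliced data is `M˙(U₀^{(AL)})` itself whenever `exp(i0) = 1` — PROVED (definitional). [cite: Balaban1989LargeFieldI, (1.97) p.199] -/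
theorem cfg197_zero (sol : ((j : ℕ) → GaugeField P j G) → GaugeField P 0 G) (Sig : (j : ℕ) → Set (PBond P j))
    (MU0 : (j : ℕ) → GaugeField P j G) (hexp : χ.expI 0 = 1) :
    cfg197 χ sol Sig (fun _ _ => 0) MU0 = sol MU0 := by
  unfold cfg197
  congr 1
  funext j b
  split_ifs
  · rfl
  · rw [hexp, one_mul]

end LastStep

end Literature.MathematicalPhysics.QuantumFieldTheory.Balaban1983to89.B15StandardRep
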